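import Summits.HodgeConjecture.HodgeConjecture.Theorems.PadicSemiregularLiftHodgeAbelianVarietiesCMPivotBridge
import Mathlib.LinearAlgebra.Matrix.Charpoly.Minpoly
import Mathlib.LinearAlgebra.Eigenspace.Minpoly
import Mathlib.LinearAlgebra.Charpoly.ToMatrix
import Mathlib.LinearAlgebra.Eigenspace.Charpoly
import Mathlib.FieldTheory.IsAlgClosed.Basic
import Mathlib.FieldTheory.Perfect
import Mathlib.FieldTheory.Separable
import Mathlib.Algebra.Squarefree.Basic
import HarnessLib

/-!
# Crux `HodgeAbelianVarieties` (stmt-HodgeConjecture-1333), line `cm-pivot` gen 4 — the CONVERSE CM-typing bridge (composition step)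

Route `PadicSemiregularLift`, crux r4; line `cm-pivot` (decomposition `HodgeAbelianVarieties ⇐ HodgeCM ∧ …`). c6's bridge
`CMPivot.cmSubalgebra_of_isCM` proves `IsCM[A] ⟹ ∃ S ⊆ End⁰(A)` commutative reduced of rank `2 dim A` (the CM hypothesis
of the shared item `CMAbelianHodge`, stmt-HodgeConjecture-3052). This file proves the CONVERSE, modulo the two registered
gen-4 stubs it composes (taken here as explicit hypotheses, verbatim their registered signatures):

* (stub 4, `stub_etalePrimitive`) a commutative reduced subalgebra `S` of a `ℚ`-algebra with `0 < finrank ℚ S` has an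
  element whose minimal polynomial has degree `finrank ℚ S`;
* (stub 5, `stub_rationalRepresentation`) the faithful rational representation `σ : End⁰(A) →ₐ[ℚ] M_{2 dim A}(ℚ)` with
  `σ(1 ⊗ f) ⊗ ℂ = (matrix of f^* in a basis b of H¹(A(ℂ); ℂ))ᵀ`.

Main results:
* `squarefree_minpoly_of_isReduced_ring` — in a reduced `ℚ`-algebra the minimal polynomial of an integral element is square-free.
* `isCM_of_cmSubalgebra_of_stubs` — **stub 4 ⟹ stub 5 ⟹ (∃ S ⊆ End⁰(A) commutative reduced, finrank ℚ S = 2 dim A) ⟹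
  some endomorphism of `A` has `2 dim A` distinct eigenvalues on `H¹(A(ℂ); ℂ)`** (`IsCM[A]`).

Proof of the main result: `dim A = 0` is vacuous (`Fin 0`). Otherwise `S` is finite-dimensional; pick `s ∈ S` with
`deg minpoly ℚ s = 2 dim A =: 2g` (stub 4); `minpoly ℚ s` is square-free (reducedness); clear denominators `n • s = 1 ⊗ f`
(`CMPivot.exists_nsmul_eq_tmul`); `N := σ s` has `minpoly ℚ N = minpoly ℚ s` (injectivity of `σ`), which divides the monic
degree-`2g` characteristic polynomial, hence equals it; so `charpoly N` is square-free = separable, and over `ℂ` it has `2g`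
distinct roots `λᵢ`, each an eigenvalue of `T := (N ⊗ ℂ)ᵀ` read as an endomorphism of `H¹` in the basis `b`
(`Module.End.hasEigenvalue_iff_isRoot_charpoly`); finally `f^* = n • T` (stub 5 and `σ(1 ⊗ f) = n • N`), so `f^*` has the
`2g` distinct eigenvalues `n λᵢ`. References: [MumfordAV1970] §19 Thm. 3 and §22; Shimura–Taniyama (1961) §5.1.
-/

set_option linter.dupNamespace false

noncomputable section

open CategoryTheory Polynomial
open scoped Matrix TensorProduct
open Literature.AlgebraicGeometry Literature.AlgebraicGeometry.Motives
  Literature.AlgebraicGeometry.HodgeTheory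

namespace Summit.HodgeConjecture.HodgeConjecture.Theorems.HodgeAbelianVarieties.CMPivot

/-! ### Square-free minimal polynomials in reduced algebras -/

section Reduced

variable {R : Type*} [Ring R] [Algebra ℚ R]

/-- **In a reduced (possibly non-commutative) `ℚ`-algebra the minimal polynomial of an integral element is
square-free**: if `minpoly = p² q` then `(p q)(x)² = minpoly(x) · q(x) = 0`, so `(p q)(x) = 0` by reducedness, so
`minpoly ∣ p q` and a degree count forces `deg p = 0`. (The tree's
`Literature.AlgebraicGeometry.Crystalline.squarefree_minpoly_of_isReduced` is the same statement for a COMMUTATIVE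
ambient ring; here the ambient ring is a subalgebra of the non-commutative `End⁰(A)`.) [folklore] -/
theorem squarefree_minpoly_of_isReduced_ring [IsReduced R] {x : R} (hx : IsIntegral ℚ x) :
    Squarefree (minpoly ℚ x) := by
  intro p hp
  obtain ⟨q, hq⟩ := hp
  have hm0 : minpoly ℚ x ≠ 0 := minpoly.ne_zero hx
  have hp0 : p ≠ 0 := by
    rintro rfl
    exact hm0 (by rw [hq, zero_mul, zero_mul])
  have hq0 : q ≠ 0 := by
    rintro rfl
    exact hm0 (by rw [hq, mul_zero])
  -- `(p q)(x)` is nilpotent, hence zero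
  have hnil : IsNilpotent (aeval x (p * q)) := by
    refine ⟨2, ?_⟩
    have : (p * q) ^ 2 = minpoly ℚ x * q := by rw [hq]; ring
    rw [← map_pow, this, map_mul, minpoly.aeval, zero_mul]
  have hzero : aeval x (p * q) = 0 := hnil.eq_zero
  have hdvd : minpoly ℚ x ∣ p * q := minpoly.dvd ℚ x hzero
  have hpq0 : p * q ≠ 0 := mul_ne_zero hp0 hq0
  have hdeg := Polynomial.natDegree_le_of_dvd hdvd hpq0
  rw [hq, Polynomial.natDegree_mul (mul_ne_zero hp0 hp0) hq0, Polynomial.natDegree_mul hp0 hp0,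
    Polynomial.natDegree_mul hp0 hq0] at hdeg
  have hp_deg : p.natDegree = 0 := by omega
  rw [Polynomial.eq_C_of_natDegree_eq_zero hp_deg]
  refine Polynomial.isUnit_C.mpr (IsUnit.mk0 _ fun h => hp0 ?_)
  rw [Polynomial.eq_C_of_natDegree_eq_zero hp_deg, h, map_zero]

end Reduced

/-! ### The converse bridge from the two gen-4 stubs -/

section Converse

/-- `IsCM[A]` — CM type in the typing of the `HodgeAbelianVarieties` crux lines (verbatim from
`Cruxes/HodgeAbelianVarieties/Lines/cm_pivot.lean`). Local notation only. -/
local notation3 (prettyPrint := false) "IsCM[" A "]" =>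
  ∃ (ψ : A ⟶ A) (μ : Fin (2 * AbelianVariety.dim A) → ℂ), Function.Injective μ ∧
    ∀ i, Module.End.HasEigenvalue (HodgeTheory.complexBetti.map ψ.hom.hom.hom 1).hom (μ i)

/-- `EtalePrimitive[]` — VERBATIM the registered signature of stub 4 `stub_etalePrimitive` (universe-monomorphic form).
Local notation only. -/
local notation3 (prettyPrint := false) "EtalePrimitive[]" =>
  ∀ {C : Type} [Ring C] [Algebra ℚ C] (S : Subalgebra ℚ C), IsReduced ↥S → (∀ x ∈ S, ∀ y ∈ S, x * y = y * x) →
    0 < Module.finrank ℚ ↥S → ∃ s ∈ S, (minpoly ℚ s).natDegree = Module.finrank ℚ ↥S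

/-- `RationalRep[]` — VERBATIM the registered signature of stub 5 `stub_rationalRepresentation`. Local notation only. -/
local notation3 (prettyPrint := false) "RationalRep[]" =>
  ∀ A : AbelianVariety ℂ, ∃ (b : Module.Basis (Fin (2 * A.dim)) ℂ (HodgeTheory.complexBetti A.X 1))
    (σ : A.endAlgebra →ₐ[ℚ] Matrix (Fin (2 * A.dim)) (Fin (2 * A.dim)) ℚ),
    Function.Injective σ ∧
    ∀ f : A ⟶ A, (σ (AbelianVariety.endAlgebra.of A f)).map (algebraMap ℚ ℂ) =
      (LinearMap.toMatrix b b (HodgeTheory.complexBetti.map f.hom.hom.hom 1).hom)ᵀ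

/-- **The converse CM-typing bridge, from the two gen-4 stubs**: granted the primitive element theorem for finite étale
`ℚ`-algebras (stub 4) and the packaged faithful rational representation on `H¹` (stub 5), a complex abelian variety whose
`End⁰(A)` contains a commutative reduced `ℚ`-subalgebra of dimension `2 · dim A` has an endomorphism with `2 · dim A`
distinct eigenvalues on `H¹(A(ℂ); ℂ)`. [cite: MumfordAV1970, §19 Thm. 3 and §22] -/
theorem isCM_of_cmSubalgebra_of_stubs (hα : EtalePrimitive[]) (hβ : RationalRep[]) :
    ∀ A : AbelianVariety ℂ,
      (∃ S : Subalgebra ℚ A.endAlgebra, IsReduced ↥S ∧ (∀ x ∈ S, ∀ y ∈ S, x * y = y * x) ∧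
        Module.finrank ℚ ↥S = 2 * A.dim) → IsCM[A] := by
  classical
  intro A ⟨S, hred, hcomm, hfr⟩
  haveI := finite_complexBetti_abelianVariety A 1
  rcases Nat.eq_zero_or_pos A.dim with hdim | hdim
  · -- `dim A = 0`: `Fin 0` is empty
    refine ⟨𝟙 A, fun i => (i : ℕ), fun i j h => Fin.ext (Nat.cast_injective (R := ℂ) (by simpa using h)),
      fun i => ?_⟩
    exact absurd i.2 (by omega)
  -- `dim A > 0`
  have hg2pos : 0 < 2 * A.dim := by omega
  haveI : Module.Finite ℚ S := Module.finite_of_finrank_pos (by rw [hfr]; exact hg2pos)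
  haveI : IsReduced S := hred
  -- stub 4: a primitive element
  obtain ⟨s, hsS, hdeg⟩ := hα S hred hcomm (by rw [hfr]; exact hg2pos)
  rw [hfr] at hdeg
  -- integrality and square-freeness of `minpoly ℚ s`, computed inside `S`
  set s' : S := ⟨s, hsS⟩ with hs'_def
  have hSval_inj : Function.Injective S.val := Subtype.coe_injective
  have hs'int : IsIntegral ℚ s' := Algebra.IsIntegral.isIntegral s'
  have hsint : IsIntegral ℚ s := by
    have := hs'int.map S.val
    exact this
  have hmin_s' : minpoly ℚ s = minpoly ℚ s' := by
    have := minpoly.algHom_eq S.val hSval_inj s'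
    exact this
  have hsq : Squarefree (minpoly ℚ s) := by
    rw [hmin_s']
    exact squarefree_minpoly_of_isReduced_ring hs'int
  -- stub 5: the rational representation
  obtain ⟨b, σ, hσinj, hσ⟩ := hβ A
  -- clear denominators: `n • s = 1 ⊗ f`
  obtain ⟨n, hn, f, hf⟩ := exists_nsmul_eq_tmul A s
  have hf' : (n : ℚ) • s = AbelianVariety.endAlgebra.of A f := hf
  -- the matrix `N = σ s`, its minimal and characteristic polynomials
  set N : Matrix (Fin (2 * A.dim)) (Fin (2 * A.dim)) ℚ := σ s with hN_def
  set P : ℚ[X] := minpoly ℚ s with hP_def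
  have hNint : IsIntegral ℚ N := Matrix.isIntegral N
  have hminN : minpoly ℚ N = P := by
    rw [hN_def]
    exact minpoly.algHom_eq σ hσinj s
  have hchar : N.charpoly = P := by
    refine Polynomial.eq_of_monic_of_dvd_of_natDegree_le (minpoly.monic hNint) (Matrix.charpoly_monic N)
      (Matrix.minpoly_dvd_charpoly N) ?_ |>.trans hminN
    rw [Matrix.charpoly_natDegree_eq_dim, Fintype.card_fin, hminN, hP_def, hdeg]
  -- complexification: `T := ((σ s) ⊗ ℂ)ᵀ` as an endomorphism of `H¹` in the basis `b`
  set Nc : Matrix (Fin (2 * A.dim)) (Fin (2 * A.dim)) ℂ := N.map (algebraMap ℚ ℂ) with hNc_def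
  set T : HodgeTheory.complexBetti A.X 1 →ₗ[ℂ] HodgeTheory.complexBetti A.X 1 :=
    Matrix.toLin b b Ncᵀ with hT_def
  have hcharT : T.charpoly = P.map (algebraMap ℚ ℂ) := by
    rw [← LinearMap.charpoly_toMatrix T b, hT_def, LinearMap.toMatrix_toLin, Matrix.charpoly_transpose, hNc_def,
      Matrix.charpoly_map, hchar]
  -- `f^* = n • T`
  have hfT : (HodgeTheory.complexBetti.map f.hom.hom.hom 1).hom = (n : ℂ) • T := by
    apply (LinearMap.toMatrix b b).injective
    rw [LinearEquiv.map_smul, hT_def, LinearMap.toMatrix_toLin]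
    have h1 := hσ f
    rw [← hf', map_smul] at h1
    -- `h1 : ((n : ℚ) • N).map (algebraMap ℚ ℂ) = (toMatrix b b f^*)ᵀ`
    have h2 : LinearMap.toMatrix b b (HodgeTheory.complexBetti.map f.hom.hom.hom 1).hom =
        (((n : ℚ) • σ s).map (algebraMap ℚ ℂ))ᵀ := by
      rw [h1, Matrix.transpose_transpose]
    rw [h2]
    ext i j
    simp only [Matrix.transpose_apply, Matrix.map_apply, Matrix.smul_apply, hNc_def, hN_def, smul_eq_mul,
      map_mul, map_natCast]
  -- the roots of `P ⊗ ℂ`: `2 dim A` distinct complex numbers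
  set Pc : ℂ[X] := P.map (algebraMap ℚ ℂ) with hPc_def
  have hP0 : P ≠ 0 := minpoly.ne_zero hsint
  have hPc0 : Pc ≠ 0 := (Polynomial.map_ne_zero_iff (algebraMap ℚ ℂ).injective).mpr hP0
  have hsep : P.Separable := PerfectField.separable_iff_squarefree.mpr hsq
  have hsepc : Pc.Separable := hsep.map
  have hnodup : Pc.roots.Nodup := Polynomial.nodup_roots hsepc
  have hsplit : Pc.Splits := IsAlgClosed.splits Pc
  have hcardroots : Pc.roots.card = 2 * A.dim := by
    rw [← hdeg, ← Polynomial.natDegree_map_eq_of_injective (algebraMap ℚ ℂ).injective P]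
    exact (Polynomial.splits_iff_card_roots.mp hsplit)
  have hcardfin : Pc.roots.toFinset.card = 2 * A.dim := by
    rw [Multiset.toFinset_card_of_nodup hnodup, hcardroots]
  let e : {x // x ∈ Pc.roots.toFinset} ≃ Fin (2 * A.dim) := Finset.equivFinOfCardEq hcardfin
  have hn0 : (n : ℂ) ≠ 0 := by exact_mod_cast hn.ne'
  refine ⟨f, fun i => (n : ℂ) * ((e.symm i : {x // x ∈ Pc.roots.toFinset}) : ℂ), ?_, ?_⟩
  · intro i j hij
    have h1 : ((e.symm i : {x // x ∈ Pc.roots.toFinset}) : ℂ) = (e.symm j : {x // x ∈ Pc.roots.toFinset}) :=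
      mul_left_cancel₀ hn0 hij
    exact e.symm.injective (Subtype.ext h1)
  · intro i
    set lam : ℂ := ((e.symm i : {x // x ∈ Pc.roots.toFinset}) : ℂ) with hlam
    have hroot : Pc.IsRoot lam := by
      have hmem : lam ∈ Pc.roots.toFinset := (e.symm i).2
      rw [Multiset.mem_toFinset, Polynomial.mem_roots hPc0] at hmem
      exact hmem
    have hTev : Module.End.HasEigenvalue T lam := by
      rw [Module.End.hasEigenvalue_iff_isRoot_charpoly, hcharT]
      exact hroot
    obtain ⟨v, hv⟩ := hTev.exists_hasEigenvector
    have hv' : Module.End.HasEigenvector (HodgeTheory.complexBetti.map f.hom.hom.hom 1).hom ((n : ℂ) * lam) v := by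
      refine ⟨?_, hv.2⟩
      rw [Module.End.mem_eigenspace_iff, hfT, LinearMap.smul_apply, hv.apply_eq_smul, smul_smul]
    exact Module.End.hasEigenvalue_of_hasEigenvector hv'

end Converse

end Summit.HodgeConjecture.HodgeConjecture.Theorems.HodgeAbelianVarieties.CMPivot

end
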